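import Summits.CriticalPhenomena.PercolationContinuityZ3.Theorems.PercNearOneGluingNoHeavyQuantCountDP
import HarnessLib

/-!
# QUANT lane R8 tool: the BLOB-WALK exchange calculus — cdf recursion `CB[a, p, m]` of a sum of independent blobs,
# the crossing / point-of-no-return identities, and the two routes from window inequalities to the FAR exchange form on block-combs

builds on p205010 (kernel theorem, internal audit signed; external expert review pending)

Support file (`--supports stmt-CriticalPhenomena-4575`), QUANT lane lead (gen 10), rung R8 of
`run/shared/lean/prim/quant/LADDER.md`; paper `run/shared/lean/prim/quant/prim-quant-lead-g10/LEAD-NOTES-G10.md` N21.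
Pure real algebra on an explicit recursion (the analogue, for blobs of sizes `a k`, of p1 g6's `PB[p, m]` in
`…QuantCountDP.lean`); no probability space, no definitions (a local notation for a `Nat.rec` term), no sorries, standard axioms.

**Setting.**  Blobs `k` with sizes `a k : ℕ` and gates `p k : ℝ`; `S_m = Σ_{k<m} a k · ε k`.  `CB[a, p, m] t` (`t : ℤ`) = `P(S_m ≤ t)`,
DEFINED by `CB[a,p,0] t = [0 ≤ t]`, `CB[a,p,m+1] t = p m · CB[a,p,m] (t − a m) + (1 − p m) · CB[a,p,m] t`.  The WINDOW mass
`CB[m] t − CB[m] (t − a m) = P(t − a m < S_m ≤ t)` is the probability of an OPPORTUNITY at `m` for level `t` (blob `m`, if open, crosses `t`).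
For a block-comb (chain weights `w k` non-increasing, terminal block `c` at weight `x`, marginals `w k · p k ≥ x`) the far-relay row at layer
`j` is, by `Quant.spine_identity` + Abel (N21 (1); tree side NOT in this file):
`P(N ≥ j+1) − x = Σ_{k<K} (w k − x) · p k · (CB[k] j − CB[k] (j − a k)) − x · CB[K] (j − c)`.  Walk side, this file:
* `CB_cross` — crossing identity `CB[0] t − CB[K] t = Σ_{k<K} p k · window_k(t)`;  `CB_ponr` — point-of-no-return identity
  `CB[K] t = CB[0](t − A_K) + Σ_{k<K} (1 − p k) · window_k(t − T k)`, `T k = Σ_{k<i<K} a i` (DANGER windows); iid forms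
  `CB_cross_const` / `CB_ponr_const` (E[#opportunities] = P(S_K > t)/g, E[#dangers] = (P(S_K ≤ t) − [A_K ≤ t])/(1−g)).
* `abel_identity`, `abel_nonneg`, `sum_le_sum_of_prefix` — Abel summation with a sandwich `μ k ≤ λ i (i ≤ k)`.
* `exchange_of_prefixWindow` — REGIME ROUTE (N21 (2),(4)): `0 ≤ x ≤ w i · p k` (`i ≤ k < K`), `j − c < A_K`, and prefix window domination
  `Σ_{k<m} danger_k ≤ Σ_{k<m} window_k(j)` (`m ≤ K`) give `x · CB[K](j − c) ≤ Σ_{k<K} (w k − x) p k · window_k(j)` = the FAR exchange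
  inequality (the hypothesis is the lead's conjecture (TW)/(PW) under `A·min p + c > 2j`; kit censuses j106947 / j107110; FALSE under the
  weak budget, N21 (5)).
* `exchange_of_const` — EQUAL-GATE ROUTE (N21 (3)): constant gates `g`, and the iid block-star inequality `g·CB[K](j−c) ≤ (1−g)(1 − CB[K] j)`
  (`IndepBlob.far_indepBlob` in the canonical model, supplied by the caller) give the same exchange inequality.
Exact re-check: `prim-quant-lead-g10/explore/n21_checks.py` (1 500 rational instances / 0).  [this work] unless marked [folklore].
-/

noncomputable section

namespace Summit.CriticalPhenomena.PercolationContinuityZ3.Theorems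

namespace Quant

namespace BlobWalk

open Finset

/-- `CB[a, p, m] t` = probability that the open mass of the first `m` blobs (sizes `a`, gates `p`) is `≤ t`, as the explicit recursion. -/
local notation3 "CB[" a ", " p ", " m "]" =>
  (Nat.rec (motive := fun _ => ℤ → ℝ) (fun t => if (0 : ℤ) ≤ t then (1 : ℝ) else 0)
    (fun n f t => (p : ℕ → ℝ) n * f (t - ((a : ℕ → ℕ) n : ℤ)) + (1 - (p : ℕ → ℝ) n) * f t) (m : ℕ))

variable (a : ℕ → ℕ) (p : ℕ → ℝ)

/-! ### The recursion and bookkeeping -/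

/-- No blobs: `S_0 = 0`, so `CB[a,p,0] t = [0 ≤ t]`. [folklore] -/
theorem CB_zero (t : ℤ) : CB[a, p, 0] t = if (0 : ℤ) ≤ t then (1 : ℝ) else 0 := rfl

/-- One more blob: `CB[a,p,m+1] t = p m · CB[a,p,m] (t − a m) + (1 − p m) · CB[a,p,m] t`. [folklore] -/
theorem CB_succ (m : ℕ) (t : ℤ) :
    CB[a, p, m + 1] t = p m * CB[a, p, m] (t - (a m : ℤ)) + (1 - p m) * CB[a, p, m] t := rfl

/-- `CB[a,p,0] t = 1` for `t ≥ 0`. [folklore] -/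
theorem CB_zero_of_nonneg {t : ℤ} (ht : 0 ≤ t) : CB[a, p, 0] t = 1 := by rw [CB_zero, if_pos ht]
/-- `CB[a,p,0] t = 0` for `t < 0`. [folklore] -/
theorem CB_zero_of_neg {t : ℤ} (ht : t < 0) : CB[a, p, 0] t = 0 := by rw [CB_zero, if_neg (not_le.2 ht)]

/-- Below zero the cdf vanishes: `CB[a,p,m] t = 0` for `t < 0`. [folklore] -/
theorem CB_of_neg (m : ℕ) : ∀ t : ℤ, t < 0 → CB[a, p, m] t = 0 := by
  induction m with
  | zero => intro t ht; exact CB_zero_of_neg a p ht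
  | succ m ih =>
    intro t ht
    rw [CB_succ, ih t ht, ih (t - (a m : ℤ)) (by have := Int.natCast_nonneg (a m); omega)]
    ring

/-- Above the total size the cdf is one: `CB[a,p,m] t = 1` for `t ≥ Σ_{k<m} a k`. [folklore] -/
theorem CB_of_ge (m : ℕ) : ∀ t : ℤ, ((∑ k ∈ Finset.range m, a k : ℕ) : ℤ) ≤ t → CB[a, p, m] t = 1 := by
  induction m with
  | zero => intro t ht; exact CB_zero_of_nonneg a p (by simpa using ht)
  | succ m ih =>
    intro t ht
    rw [Finset.sum_range_succ, Nat.cast_add] at ht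
    have h0 : (0 : ℤ) ≤ ((a m : ℕ) : ℤ) := Int.natCast_nonneg (a m)
    rw [CB_succ, ih t (by omega), ih (t - (a m : ℤ)) (by omega)]
    ring

/-- Monotonicity in the level: `CB[a,p,m] t ≤ CB[a,p,m] t'` for `t ≤ t'` (gates in `[0,1]`). [folklore] -/
theorem CB_mono (hp : ∀ k, 0 ≤ p k ∧ p k ≤ 1) (m : ℕ) : ∀ t t' : ℤ, t ≤ t' → CB[a, p, m] t ≤ CB[a, p, m] t' := by
  induction m with
  | zero =>
    intro t t' htt'
    rw [CB_zero, CB_zero]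
    by_cases h1 : (0 : ℤ) ≤ t
    · rw [if_pos h1, if_pos (h1.trans htt')]
    · rw [if_neg h1]; split_ifs <;> norm_num
  | succ m ih =>
    intro t t' htt'
    rw [CB_succ, CB_succ]
    have h1 := ih (t - (a m : ℤ)) (t' - (a m : ℤ)) (by omega)
    have h2 := ih t t' htt'
    have hpm := hp m
    nlinarith [mul_le_mul_of_nonneg_left h1 hpm.1, mul_le_mul_of_nonneg_left h2 (sub_nonneg.2 hpm.2)]

/-- `0 ≤ CB[a,p,m] t`. [folklore] -/
theorem CB_nonneg (hp : ∀ k, 0 ≤ p k ∧ p k ≤ 1) (m : ℕ) : ∀ t : ℤ, 0 ≤ CB[a, p, m] t := by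
  induction m with
  | zero => intro t; rw [CB_zero]; split_ifs <;> norm_num
  | succ m ih =>
    intro t
    rw [CB_succ]
    have hpm := hp m
    exact add_nonneg (mul_nonneg hpm.1 (ih _)) (mul_nonneg (sub_nonneg.2 hpm.2) (ih _))

/-- `CB[a,p,m] t ≤ 1`. [folklore] -/
theorem CB_le_one (hp : ∀ k, 0 ≤ p k ∧ p k ≤ 1) (m : ℕ) : ∀ t : ℤ, CB[a, p, m] t ≤ 1 := by
  induction m with
  | zero => intro t; rw [CB_zero]; split_ifs <;> norm_num
  | succ m ih =>
    intro t
    rw [CB_succ]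
    have hpm := hp m
    nlinarith [mul_le_mul_of_nonneg_left (ih (t - (a m : ℤ))) hpm.1,
      mul_le_mul_of_nonneg_left (ih t) (sub_nonneg.2 hpm.2)]

/-- The window (opportunity) mass is nonnegative: `0 ≤ CB[a,p,m] t − CB[a,p,m] (t − a m)`. [folklore] -/
theorem window_nonneg (hp : ∀ k, 0 ≤ p k ∧ p k ≤ 1) (m : ℕ) (t : ℤ) :
    0 ≤ CB[a, p, m] t - CB[a, p, m] (t - (a m : ℤ)) :=
  sub_nonneg.2 (CB_mono a p hp m _ _ (by have := Int.natCast_nonneg (a m); omega))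

/-! ### The crossing identity and the point-of-no-return identity -/

/-- **Crossing identity.**  `CB[a,p,0] t − CB[a,p,K] t = Σ_{k<K} p k · (CB[a,p,k] t − CB[a,p,k] (t − a k))`: the probability that the open
mass of `K` blobs exceeds `t` is the sum over the crossing index `k` of `p k · P(t − a k < S_k ≤ t)`. [this work] -/
theorem CB_cross (K : ℕ) (t : ℤ) :
    CB[a, p, 0] t - CB[a, p, K] t = ∑ k ∈ Finset.range K, p k * (CB[a, p, k] t - CB[a, p, k] (t - (a k : ℤ))) := by
  induction K with
  | zero => simp
  | succ K ih =>
    rw [Finset.sum_range_succ, ← ih, CB_succ]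
    ring

/-- **Point-of-no-return identity.**  With `A_K = Σ_{k<K} a k` and the tail sizes `T k = Σ_{i ∈ (k, K)} a i`:
`CB[a,p,K] t = CB[a,p,0] (t − A_K) + Σ_{k<K} (1 − p k) · (CB[a,p,k] (t − T k) − CB[a,p,k] (t − T k − a k))`.
The walk ends `≤ t` iff it is short from the start (`A_K ≤ t`) or, at a unique `k`, the walk sat in the DANGER window
`(t − T k − a k, t − T k]` and blob `k` stayed closed. [this work] -/
theorem CB_ponr (K : ℕ) : ∀ t : ℤ,
    CB[a, p, K] t = CB[a, p, 0] (t - ((∑ k ∈ Finset.range K, a k : ℕ) : ℤ)) +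
      ∑ k ∈ Finset.range K, (1 - p k) *
        (CB[a, p, k] (t - ((∑ i ∈ Finset.Ico (k + 1) K, a i : ℕ) : ℤ)) -
          CB[a, p, k] (t - ((∑ i ∈ Finset.Ico (k + 1) K, a i : ℕ) : ℤ) - (a k : ℤ))) := by
  induction K with
  | zero => intro t; simp
  | succ K ih =>
    intro t
    -- one more blob at the end: `CB[K+1] t = CB[K] (t − a K) + (1 − p K)(CB[K] t − CB[K] (t − a K))`
    have hstep : CB[a, p, K + 1] t =
        CB[a, p, K] (t - (a K : ℤ)) + (1 - p K) * (CB[a, p, K] t - CB[a, p, K] (t - (a K : ℤ))) := by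
      rw [CB_succ]; ring
    have hA : ((∑ k ∈ Finset.range (K + 1), a k : ℕ) : ℤ) = ((∑ k ∈ Finset.range K, a k : ℕ) : ℤ) + (a K : ℤ) := by
      rw [Finset.sum_range_succ, Nat.cast_add]
    -- the tail sums: for `k < K`, `Σ_{i ∈ (k, K+1)} a i = Σ_{i ∈ (k, K)} a i + a K`; for `k = K` it is empty
    have htail : ∀ k ∈ Finset.range K,
        ((∑ i ∈ Finset.Ico (k + 1) (K + 1), a i : ℕ) : ℤ) = ((∑ i ∈ Finset.Ico (k + 1) K, a i : ℕ) : ℤ) + (a K : ℤ) := by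
      intro k hk
      rw [Finset.mem_range] at hk
      rw [Finset.sum_Ico_succ_top (by omega : k + 1 ≤ K), Nat.cast_add]
    have hempty : ((∑ i ∈ Finset.Ico (K + 1) (K + 1), a i : ℕ) : ℤ) = 0 := by simp
    rw [hA, Finset.sum_range_succ, hempty, sub_zero]
    have hsum : ∑ k ∈ Finset.range K, (1 - p k) *
          (CB[a, p, k] (t - ((∑ i ∈ Finset.Ico (k + 1) (K + 1), a i : ℕ) : ℤ)) -
            CB[a, p, k] (t - ((∑ i ∈ Finset.Ico (k + 1) (K + 1), a i : ℕ) : ℤ) - (a k : ℤ))) =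
        ∑ k ∈ Finset.range K, (1 - p k) *
          (CB[a, p, k] (t - (a K : ℤ) - ((∑ i ∈ Finset.Ico (k + 1) K, a i : ℕ) : ℤ)) -
            CB[a, p, k] (t - (a K : ℤ) - ((∑ i ∈ Finset.Ico (k + 1) K, a i : ℕ) : ℤ) - (a k : ℤ))) := by
      refine Finset.sum_congr rfl fun k hk => ?_
      rw [htail k hk]
      have e1 : t - (((∑ i ∈ Finset.Ico (k + 1) K, a i : ℕ) : ℤ) + (a K : ℤ)) =
          t - (a K : ℤ) - ((∑ i ∈ Finset.Ico (k + 1) K, a i : ℕ) : ℤ) := by ring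
      rw [e1]
    have e3 : t - (((∑ k ∈ Finset.range K, a k : ℕ) : ℤ) + (a K : ℤ)) =
        t - (a K : ℤ) - ((∑ k ∈ Finset.range K, a k : ℕ) : ℤ) := by ring
    rw [hsum, e3, hstep, ih (t - (a K : ℤ))]
    ring

/-! ### Constant gates: the two telescoping identities -/

/-- **iid crossing identity.**  For constant gates `g`: `g · Σ_{k<K} (CB[k] t − CB[k] (t − a k)) = CB[0] t − CB[K] t`, i.e. the expected
number of opportunities at level `t` equals `P(S_K > t)/g`. [this work] -/
theorem CB_cross_const (g : ℝ) (K : ℕ) (t : ℤ) :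
    g * ∑ k ∈ Finset.range K, (CB[a, (fun _ => g), k] t - CB[a, (fun _ => g), k] (t - (a k : ℤ))) =
      CB[a, (fun _ => g), 0] t - CB[a, (fun _ => g), K] t := by
  rw [CB_cross a (fun _ => g) K t, Finset.mul_sum]

/-- **iid point-of-no-return identity.**  For constant gates `g`:
`(1 − g) · Σ_{k<K} danger_k(t) = CB[K] t − CB[0] (t − A_K)`, i.e. the expected number of dangers equals `(P(S_K ≤ t) − [A_K ≤ t])/(1 − g)`.
[this work] -/
theorem CB_ponr_const (g : ℝ) (K : ℕ) (t : ℤ) :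
    (1 - g) * ∑ k ∈ Finset.range K,
        (CB[a, (fun _ => g), k] (t - ((∑ i ∈ Finset.Ico (k + 1) K, a i : ℕ) : ℤ)) -
          CB[a, (fun _ => g), k] (t - ((∑ i ∈ Finset.Ico (k + 1) K, a i : ℕ) : ℤ) - (a k : ℤ))) =
      CB[a, (fun _ => g), K] t - CB[a, (fun _ => g), 0] (t - ((∑ k ∈ Finset.range K, a k : ℕ) : ℤ)) := by
  rw [CB_ponr a (fun _ => g) K t, Finset.mul_sum]
  ring

/-! ### Abel summation with a sandwich -/

/-- Abel identity `Σ_{k<K} ν k · e k = ν K · E K + Σ_{k<K} (ν k − ν (k+1)) · E (k+1)`, `E m = Σ_{i<m} e i`. [folklore] -/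
theorem abel_identity (ν e : ℕ → ℝ) (K : ℕ) :
    ∑ k ∈ Finset.range K, ν k * e k =
      ν K * ∑ i ∈ Finset.range K, e i +
        ∑ k ∈ Finset.range K, (ν k - ν (k + 1)) * ∑ i ∈ Finset.range (k + 1), e i := by
  induction K with
  | zero => simp
  | succ K ih =>
    rw [Finset.sum_range_succ, ih, Finset.sum_range_succ (fun k => (ν k - ν (k + 1)) * _),
      Finset.sum_range_succ e]
    ring

/-- **Abel nonnegativity.**  If `ν` is nonnegative and non-increasing and all prefix sums of `e` are nonnegative, then
`0 ≤ Σ_{k<K} ν k · e k`. [folklore] -/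
theorem abel_nonneg (ν e : ℕ → ℝ) (K : ℕ) (hν0 : ∀ k, 0 ≤ ν k) (hν : ∀ k, ν (k + 1) ≤ ν k)
    (hE : ∀ m, m ≤ K → 0 ≤ ∑ i ∈ Finset.range m, e i) : 0 ≤ ∑ k ∈ Finset.range K, ν k * e k := by
  rw [abel_identity]
  refine add_nonneg (mul_nonneg (hν0 K) (hE K le_rfl)) (Finset.sum_nonneg fun k hk => ?_)
  exact mul_nonneg (sub_nonneg.2 (hν k)) (hE (k + 1) (by rw [Finset.mem_range] at hk; omega))

/-- **Sandwich + prefix domination.**  Let `D, W ≥ 0` on `[0, K)` with `Σ_{k<m} D k ≤ Σ_{k<m} W k` for every `m ≤ K`, and let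
`μ ≥ 0`, `λ` satisfy `μ k ≤ λ i` whenever `i ≤ k < K`.  Then `Σ_{k<K} μ k · D k ≤ Σ_{k<K} λ k · W k`
(insert the non-increasing prefix minimum of `λ` between `μ` and `λ` and sum by parts). [this work] -/
theorem sum_le_sum_of_prefix (μ lam D W : ℕ → ℝ) (K : ℕ) (hμ0 : ∀ k, k < K → 0 ≤ μ k)
    (hD : ∀ k, k < K → 0 ≤ D k) (hW : ∀ k, k < K → 0 ≤ W k)
    (hsand : ∀ i k, i ≤ k → k < K → μ k ≤ lam i)
    (hpre : ∀ m, m ≤ K → ∑ k ∈ Finset.range m, D k ≤ ∑ k ∈ Finset.range m, W k) :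
    ∑ k ∈ Finset.range K, μ k * D k ≤ ∑ k ∈ Finset.range K, lam k * W k := by
  let ν : ℕ → ℝ := fun k => Nat.rec (motive := fun _ => ℝ) (max (lam 0) 0)
    (fun n v => if n + 1 < K then min v (max (lam (n + 1)) 0) else v) k
  have hν0' : ν 0 = max (lam 0) 0 := rfl
  have hνs : ∀ n, ν (n + 1) = if n + 1 < K then min (ν n) (max (lam (n + 1)) 0) else ν n := fun n => rfl
  have hνanti : ∀ k, ν (k + 1) ≤ ν k := by
    intro k; rw [hνs]; split_ifs
    · exact min_le_left _ _
    · exact le_rfl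
  have hνnonneg : ∀ k, 0 ≤ ν k := by
    intro k
    induction k with
    | zero => rw [hν0']; exact le_max_right _ _
    | succ k ih =>
      rw [hνs]; split_ifs
      · exact le_min ih (le_max_right _ _)
      · exact ih
  have hνle : ∀ k, k < K → ν k ≤ max (lam k) 0 := by
    intro k hk
    cases k with
    | zero => rw [hν0']
    | succ k => rw [hνs, if_pos hk]; exact min_le_right _ _
  have hμν : ∀ i k, i ≤ k → k < K → μ k ≤ ν i := by
    intro i
    induction i with
    | zero =>
      intro k hk hkK
      rw [hν0']
      exact (hsand 0 k hk hkK).trans (le_max_left _ _)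
    | succ i ih =>
      intro k hk hkK
      rw [hνs, if_pos (by omega)]
      exact le_min (ih k (by omega) hkK) ((hsand (i + 1) k hk hkK).trans (le_max_left _ _))
  have h1 : ∑ k ∈ Finset.range K, μ k * D k ≤ ∑ k ∈ Finset.range K, ν k * D k :=
    Finset.sum_le_sum fun k hk =>
      mul_le_mul_of_nonneg_right (hμν k k le_rfl (Finset.mem_range.1 hk)) (hD k (Finset.mem_range.1 hk))
  have h2 : 0 ≤ ∑ k ∈ Finset.range K, ν k * (W k - D k) := by
    refine abel_nonneg ν (fun k => W k - D k) K hνnonneg hνanti fun m hm => ?_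
    rw [Finset.sum_sub_distrib]
    exact sub_nonneg.2 (hpre m hm)
  have h3 : ∑ k ∈ Finset.range K, ν k * W k ≤ ∑ k ∈ Finset.range K, lam k * W k := by
    refine Finset.sum_le_sum fun k hk => ?_
    have hkK := Finset.mem_range.1 hk
    have hWk := hW k hkK
    have hlk : 0 ≤ lam k := (hμ0 k hkK).trans (hsand k k le_rfl hkK)
    have : max (lam k) 0 = lam k := max_eq_left hlk
    calc ν k * W k ≤ max (lam k) 0 * W k := mul_le_mul_of_nonneg_right (hνle k hkK) hWk
      _ = lam k * W k := by rw [this]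
  have h2' : ∑ k ∈ Finset.range K, ν k * D k ≤ ∑ k ∈ Finset.range K, ν k * W k := by
    have : ∑ k ∈ Finset.range K, ν k * (W k - D k) =
        ∑ k ∈ Finset.range K, ν k * W k - ∑ k ∈ Finset.range K, ν k * D k := by
      rw [← Finset.sum_sub_distrib]; exact Finset.sum_congr rfl fun k _ => by ring
    linarith
  exact h1.trans (h2'.trans h3)

/-! ### The two routes to the FAR exchange inequality on block-combs -/

/-- **Regime route (prefix window domination ⟹ exchange inequality).**  Blobs `(a k, p k)`, `k < K`, gates in `[0,1]`; chain weights
`w` and `x ≥ 0` with `x ≤ w i · p k` for all `i ≤ k < K` (for a block-comb: `w` non-increasing and every marginal `w k · p k ≥ x`);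
terminal block `c` with `j − c < A_K`.  If for every `m ≤ K` the first `m` DANGER masses (windows at `j − c − T k`,
`T k = Σ_{i∈(k,K)} a i`) are dominated in sum by the first `m` OPPORTUNITY masses (windows at `j`), then
`x · CB[K] (j − c) ≤ Σ_{k<K} (w k − x) · p k · (CB[k] j − CB[k] (j − a k))` — the far-relay row for the block-comb in exchange form.
Proof: `CB[K](j − c) = Σ (1 − p k)·danger_k` (`CB_ponr`; the constant term vanishes), the sandwich
`x(1 − p k) ≤ x(1 − p k⋆) ≤ (w i − x) p i` for `i ≤ k` (`k⋆` = a minimal gate in `[i, K)`, using `x ≤ w i · p k⋆`), and `sum_le_sum_of_prefix`.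
[this work] -/
theorem exchange_of_prefixWindow (hp : ∀ k, 0 ≤ p k ∧ p k ≤ 1) (K : ℕ) (j : ℤ) (c : ℕ) (x : ℝ) (w : ℕ → ℝ)
    (hx : 0 ≤ x) (hwx : ∀ i k, i ≤ k → k < K → x ≤ w i * p k)
    (hA : j - (c : ℤ) < ((∑ k ∈ Finset.range K, a k : ℕ) : ℤ))
    (hPW : ∀ m, m ≤ K →
      ∑ k ∈ Finset.range m,
          (CB[a, p, k] (j - (c : ℤ) - ((∑ i ∈ Finset.Ico (k + 1) K, a i : ℕ) : ℤ)) -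
            CB[a, p, k] (j - (c : ℤ) - ((∑ i ∈ Finset.Ico (k + 1) K, a i : ℕ) : ℤ) - (a k : ℤ))) ≤
        ∑ k ∈ Finset.range m, (CB[a, p, k] j - CB[a, p, k] (j - (a k : ℤ)))) :
    x * CB[a, p, K] (j - (c : ℤ)) ≤
      ∑ k ∈ Finset.range K, (w k - x) * p k * (CB[a, p, k] j - CB[a, p, k] (j - (a k : ℤ))) := by
  set D : ℕ → ℝ := fun k =>
    CB[a, p, k] (j - (c : ℤ) - ((∑ i ∈ Finset.Ico (k + 1) K, a i : ℕ) : ℤ)) -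
      CB[a, p, k] (j - (c : ℤ) - ((∑ i ∈ Finset.Ico (k + 1) K, a i : ℕ) : ℤ) - (a k : ℤ)) with hDdef
  set W : ℕ → ℝ := fun k => CB[a, p, k] j - CB[a, p, k] (j - (a k : ℤ)) with hWdef
  have hL : CB[a, p, K] (j - (c : ℤ)) = ∑ k ∈ Finset.range K, (1 - p k) * D k := by
    rw [CB_ponr a p K (j - (c : ℤ)), CB_of_neg a p 0 _ (by omega), zero_add]
  rw [hL, Finset.mul_sum]
  have e1 : ∑ k ∈ Finset.range K, x * ((1 - p k) * D k) = ∑ k ∈ Finset.range K, (x * (1 - p k)) * D k :=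
    Finset.sum_congr rfl fun k _ => by ring
  have e2 : ∑ k ∈ Finset.range K, (w k - x) * p k * (CB[a, p, k] j - CB[a, p, k] (j - (a k : ℤ))) =
      ∑ k ∈ Finset.range K, ((w k - x) * p k) * W k := Finset.sum_congr rfl fun k _ => by rw [hWdef]
  rw [e1, e2]
  refine sum_le_sum_of_prefix (fun k => x * (1 - p k)) (fun k => (w k - x) * p k) D W K
    (fun k _ => mul_nonneg hx (sub_nonneg.2 (hp k).2))
    (fun k _ => window_nonneg a p hp k _) (fun k _ => window_nonneg a p hp k _) ?_ ?_
  · -- the sandwich: for `i ≤ k < K`, `x(1 − p k) ≤ (w i − x) p i`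
    intro i k hik hkK
    have hne : (Finset.Ico i K).Nonempty := ⟨k, Finset.mem_Ico.2 ⟨hik, hkK⟩⟩
    obtain ⟨ks, hks, hmin⟩ := Finset.exists_min_image (Finset.Ico i K) p hne
    rw [Finset.mem_Ico] at hks
    have hf_le_pk : p ks ≤ p k := hmin k (Finset.mem_Ico.2 ⟨hik, hkK⟩)
    have hf_le_pi : p ks ≤ p i := hmin i (Finset.mem_Ico.2 ⟨le_rfl, by omega⟩)
    have hxw : x ≤ w i * p ks := hwx i ks hks.1 hks.2
    have hf0 : 0 ≤ p ks := (hp ks).1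
    have hf1 : p ks ≤ 1 := (hp ks).2
    have hpi1 : p i ≤ 1 := (hp i).2
    by_cases hks0 : p ks = 0
    · have hx0 : x = 0 := le_antisymm (by rw [hks0, mul_zero] at hxw; exact hxw) hx
      rw [hx0]; simp only [zero_mul, sub_zero]
      have := hwx i i le_rfl (by omega)
      rw [hx0] at this; exact this
    · have hfpos : 0 < p ks := lt_of_le_of_ne hf0 (Ne.symm hks0)
      have hwi : 0 ≤ w i := by
        by_contra hneg
        have hlt : w i < 0 := lt_of_not_ge hneg
        have : w i * p ks < 0 := mul_neg_of_neg_of_pos hlt hfpos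
        linarith
      have h1 : x * (1 - p k) ≤ x * (1 - p ks) := mul_le_mul_of_nonneg_left (by linarith) hx
      have h2 : x * (1 + p i - p ks) ≤ w i * p ks * (1 + p i - p ks) :=
        mul_le_mul_of_nonneg_right hxw (by linarith)
      have h3 : w i * p ks * (1 + p i - p ks) ≤ w i * p i := by
        have : p ks * (1 + p i - p ks) ≤ p i := by nlinarith
        nlinarith
      nlinarith
  · intro m hm
    exact hPW m hm

/-- **Equal-gate route.**  For constant gates `p ≡ g` with `0 < g ≤ 1`, chain weights with `x ≤ w k · g` (`k < K`), `x ≥ 0`, `j ≥ 0`, and the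
single iid block-star inequality `g · CB[K] (j − c) ≤ (1 − g) · (1 − CB[K] j)` (FAR at layer `j` for the independent blobs
`{(a k, g)}_{k<K} ∪ {(c, g)}`, i.e. `Quant.IndepBlob.far_indepBlob` in the canonical model — supplied by the caller), the exchange
inequality `x · CB[K](j − c) ≤ Σ_{k<K} (w k − x) · g · (CB[k] j − CB[k] (j − a k))` holds.  Proof: `(w k − x) g ≥ x (1 − g)` termwise and
`g · Σ_k window_k(j) = 1 − CB[K] j` (`CB_cross_const`).  This is FAR at every layer for block-combs with EQUAL private gates, walk side.
[this work] -/
theorem exchange_of_const (g : ℝ) (hg0 : 0 < g) (hg1 : g ≤ 1) (K : ℕ) (j : ℤ) (hj : 0 ≤ j) (c : ℕ) (x : ℝ)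
    (w : ℕ → ℝ) (hx : 0 ≤ x) (hwx : ∀ k, k < K → x ≤ w k * g)
    (hBS : g * CB[a, (fun _ => g), K] (j - (c : ℤ)) ≤ (1 - g) * (1 - CB[a, (fun _ => g), K] j)) :
    x * CB[a, (fun _ => g), K] (j - (c : ℤ)) ≤
      ∑ k ∈ Finset.range K, (w k - x) * g * (CB[a, (fun _ => g), k] j - CB[a, (fun _ => g), k] (j - (a k : ℤ))) := by
  have hp : ∀ k, 0 ≤ (fun _ : ℕ => g) k ∧ (fun _ : ℕ => g) k ≤ 1 := fun _ => ⟨hg0.le, hg1⟩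
  set W : ℕ → ℝ := fun k => CB[a, (fun _ => g), k] j - CB[a, (fun _ => g), k] (j - (a k : ℤ)) with hWdef
  have hW0 : ∀ k, 0 ≤ W k := fun k => window_nonneg a (fun _ => g) hp k j
  have h1 : ∑ k ∈ Finset.range K, x * (1 - g) * W k ≤
      ∑ k ∈ Finset.range K, (w k - x) * g * (CB[a, (fun _ => g), k] j - CB[a, (fun _ => g), k] (j - (a k : ℤ))) := by
    refine Finset.sum_le_sum fun k hk => ?_
    have hkK := Finset.mem_range.1 hk
    have : x * (1 - g) ≤ (w k - x) * g := by nlinarith [hwx k hkK]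
    exact mul_le_mul_of_nonneg_right this (hW0 k)
  have h2 : g * ∑ k ∈ Finset.range K, W k = 1 - CB[a, (fun _ => g), K] j := by
    have := CB_cross_const a g K j
    rw [CB_zero_of_nonneg a (fun _ => g) hj] at this
    simpa [hWdef] using this
  have h3 : ∑ k ∈ Finset.range K, x * (1 - g) * W k = x * (1 - g) * ∑ k ∈ Finset.range K, W k := by
    rw [Finset.mul_sum]
  have hC0 : 0 ≤ CB[a, (fun _ => g), K] (j - (c : ℤ)) := CB_nonneg a (fun _ => g) hp K _
  have h4 : x * CB[a, (fun _ => g), K] (j - (c : ℤ)) ≤ x * (1 - g) * ∑ k ∈ Finset.range K, W k := by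
    have hsum : ∑ k ∈ Finset.range K, W k = (1 - CB[a, (fun _ => g), K] j) / g := by
      field_simp; linarith [h2]
    rw [hsum]
    have key : CB[a, (fun _ => g), K] (j - (c : ℤ)) ≤ (1 - g) * (1 - CB[a, (fun _ => g), K] j) / g := by
      rw [le_div_iff₀ hg0]; linarith [hBS]
    calc x * CB[a, (fun _ => g), K] (j - (c : ℤ)) ≤ x * ((1 - g) * (1 - CB[a, (fun _ => g), K] j) / g) :=
          mul_le_mul_of_nonneg_left key hx
      _ = x * (1 - g) * ((1 - CB[a, (fun _ => g), K] j) / g) := by ring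
  exact h4.trans (h3 ▸ h1)

end BlobWalk

end Quant

end Summit.CriticalPhenomena.PercolationContinuityZ3.Theorems

end
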